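/-
Copyright: statement-level skeleton of a published paper (lit-balaban cell, Phase-2 proof seat p26). No proof claims beyond what
the kernel checks below.
-/
import Literature.MathematicalPhysics.QuantumFieldTheory.Balaban1983to89.B3Eq117Legend
import Literature.MathematicalPhysics.QuantumFieldTheory.Balaban1983to89.B3Eq37Pictures

/-!
# `Balaban1983to89.B3Eq117LegendPrecise` — T. Bałaban, *(Higgs)₂,₃ quantum fields in a finite volume. III. Renormalization*,
Commun. Math. Phys. **88** (1983) 411–445 [Balaban1983Higgs3], p. 415 [PDF 5], the two sentences AFTER the legend (1.17) and the
product pictures (1.18) — *"The above notations in (1.17) and (1.18) are not precise, but they can be made quite precise if we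
specify a number and nature of legs"* and (p. 414) *"they are divided into pairs and each pair is replaced by the corresponding
propagator"* — as KERNEL THEOREMS on the tree's picture vocabulary, plus the GLYPH DATA of the legend decided against p18's
vertex catalogue; a complement of the typer's `B3Eq117Legend` (p357621), whose `Symbol117`, `Symbol117.ofVertexKind`,
`Graph.legSymbol`/`Graph.lineSymbol`/`Graph.vertexSymbol`, `Expr1215`, `Product118.ofPair` are REUSED (nothing redeclared)

statement-level skeleton of published theorems with citation tags; proofs where landed; nothing here is a claim about the
Yang–Mills mass gap

PDF held: `paper:balaban1983-higgs-2-3-quantum-fields-finite-volume` (journal page = PDF page + 410).  p. 415 was READ AS AN IMAGE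
on the ×2 render `run/shared/lean/pub/pub-balaban/b2b-balaban-ref1/pages/1983-cmp88-higgs23-III/1983-cmp88-higgs23-III-p005-x2.png`
(the glyphs of (1.17)/(1.18) have no text layer); pp. 413–414 on `…-p003/p004-x2.png`; the text layer `p0005.txt` for the
sentences.

CITATION HEADER (lean-in-tree rule).  lit-balaban MEGA-FORMALIZATION (HOME `run/shared/lean/pub/lit-balaban/`), Phase 2, seat
**p26 gen 39** (unit `lit-balaban-p26-g39`), free-target protocol G.5-34(d): TAKING #3 (HOME/STATUS.md 2026-08-23T07:49:13Z) named
the same new stem as the typer g29's TAKING #5 (`B3Eq117Legend`, p357621 ACCEPTED ab393f6fc581 — the owner-named FREE TARGET S of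
`B3-CLOSURE.md` §5 item 19); after the fold owner r15 g15's STEM COLLISION note (2026-08-23T07:50:21Z) this seat YIELDED the stem
and re-scoped to the present complement (HOME/STATUS.md 2026-08-23T08:07:52Z).  ROW **B3.Eq1.17-1.18** of
`HOME/lit-balaban-r15/ROWS-B3.md` (fold owner r15; head = the owner's/lead's call; this file is a located member, cells only).
What the tree has (typer `B3Eq117Legend`, verbatim from its header): `Symbol117` (the eleven symbols), the dictionary
`Symbol117.ofVertexKind` with its fibres, the model dictionary `Graph.legSymbol`/`lineSymbol`/`operatorSymbol`/`vertexSymbol`,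
the p. 415 sentences *"There is at least one internal line"* (`Graph.exists_internal_line`) and *"every internal line has a
vertex at each endpoint"* (`Graph.line_endpoints`), (1.18) as `Expr1215`/`Product118.ofPair` (`ofPair_isSome_iff`) with the
analytic dictionary (`kernel_exponent_eq_sum_products`).  NOT in the tree before this file: the items (i)–(v) below.

THE PRINTED TEXT, p. 415 [PDF 5], verbatim, with the glyphs of (1.17) DESCRIBED as read on the render (the legend's words are
quoted in the typer's file): entry 1 *"an external scalar field, or a leg in a vertex"* [dot, straight stroke]; 2 *"an external
vector field, or a leg in a vertex"* [dot, wavy stroke]; 3 *"the scalar field propagator G_k(Ω, B̃)"* [straight line between two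
dots]; 4 *"the vector field propagator G_k"* [wavy line between two dots]; 5 *"the operator (1.13) acting on a scalar field leg"*
[vertical bar, one straight stroke]; 6 *"the operator Q_k acting on a vector field leg"* [vertical bar, one wavy stroke]; 7 *"the
vertices (1.14) or (1.15)"* [vertical bar with a small loop, wavy strokes with dots going up, one straight stroke]; 8 *"the vertex
(1.6)"* [two crossing straight lines through a dot: four straight legs]; 9 *"the vertex (1.7)"* [a straight line through a dot:
two straight legs]; 10 *"the vertices (1.8) or (1.9)"* [a straight line through a small circle, an arrowhead on it, wavy strokes
with dots going up]; 11 *"the vertices (1.10) or (1.11)"* [the same without the arrowhead] (1.17).  (1.18): *"a product of (1.12)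
and (1.14) or (1.15)"* [a straight stroke into the glyph 7]; *"a product of (1.13) and (1.14) or (1.15)"* [the glyph 5 into the
glyph 7]; *"a product of two factors of the form (1.14) or (1.15)"* [two glyphs 7 back to back].  Then: *"The above notations in
(1.17) and (1.18) are not precise, but they can be made quite precise if we specify a number and nature of legs. Now a graph for us
is a collection of internal lines, external legs, and vertices connected in the usual sense. There is at least one internal line,
and every internal line has a vertex at each endpoint. The construction of graphs is otherwise arbitrary."*  p. 414 [PDF 4]: *"All
the A′-legs are contracted, i.e. they are divided into pairs and each pair is replaced by the corresponding propagator. Some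
φ′-legs are replaced by external scalar fields and the remaining are again divided into pairs and each pair is replaced by a
propagator"*.  p. 413 (1.6): *"φ′(x) is a scalar field leg"*.

WHAT IS TYPED / PROVED (sorry-free; every `def` has a body; no `Prop` fact; standard axioms).
* (i) §1 THE GLYPH DATA OF (1.17), read on the render, as functions on the typer's `Symbol117`: the number of straight legs of a
  vertex glyph (`glyphScalarLegs`: × four, —•— two, glyphs 10/11 two, glyphs 5/7 one), the arrowhead (`glyphArrow`: glyph 10
  only), a wavy stroke or not (`wavy`); DECIDED against p18's catalogue data through the typer's `Symbol117.ofVertexKind`: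
  straight legs = `VertexKind.scalarLegs` (`glyphScalarLegs_ofVertexKind`), arrowhead ↔ `diffCount = 1`
  (`glyphArrow_ofVertexKind`, = the typer's fibre lemma), no wavy stroke ↔ neither A′- nor Ã-legs, i.e. exactly (1.6), (1.7),
  (1.13) (`wavy_ofVertexKind`), a wavy stroke ⇒ at least one A′- or Ã-leg for admissible parameters
  (`one_le_vectorLegs_of_wavy`), and the wavy legs of the precise glyph number d_v(v) (`wavyLegs_eq_dv`, p18's
  `dv_eq_vectorLegs_add`).
* (ii) §2 *"not precise, but they can be made quite precise if we specify a number and nature of legs"* AS A THEOREM: the glyph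
  (`ofVertexKind`) together with the number of A′-legs, the number of Ã-legs and the nature of the vertex's last factor (R-vertex
  or not) DETERMINES the catalogue vertex (`eq_of_ofVertexKind_eq`); the glyph alone does not (`ofVertexKind_not_injective`:
  (1.8)_{1,0}, (1.8)_{0,1}, (1.9)_{0,0} share glyph 10), nor does the glyph with the leg numbers without their nature
  (`nature_of_legs_needed`: (1.8)_{0,1} vs (1.9)_{0,0}); glyph 6 is not the glyph of a whole vertex (`ofVertexKind_ne_opQk`; on
  the model it marks the A′-legs of the (1.14)/(1.15) vertices — the typer's `Graph.operatorSymbol`, a reading this file adopts).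
* (iii) §3 *"divided into pairs and each pair is replaced by the corresponding propagator"* ON p18's MODEL `B3Cor23Concrete.Graph`:
  the endpoint swap of the lines (`lineSwap`, from `Graph.other`) is an involution of the legs whose support is the set of
  internal legs, hence THE NUMBER OF INTERNAL LEGS IS EVEN (`two_dvd_card_internal`, Mathlib `Equiv.Perm.two_dvd_card_support`),
  and — scalar lines joining φ′-legs, vector lines A′-legs (`other_isLeft`) — SO ARE THE INTERNAL φ′-LEGS AND THE INTERNAL A′-LEGS
  SEPARATELY (`two_dvd_card_internal_species`); every graph has a vertex and at least two legs (`nV_pos`, `two_le_card_legs`);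
  legs = external + internal with p18's *"(a number of external legs)"* (`card_legs_eq_numExtLegs_add`), and the legs the typer's
  dictionary draws WITHOUT a propagator symbol are exactly p18's external legs (`card_lineSymbol_none_eq_numExtLegs`).
* (iv) §4 (1.18) read with the glyphs: the legend entry each expression type is drawn with (`exprSymbol`: (1.12) ↦ 1 — p. 415
  l. 1–2 *"The external scalar field is … (1.12)"* —, (1.13) ↦ 5, (1.14)/(1.15) ↦ 7; consistent with `ofVertexKind`,
  `exprSymbol_toVertexKind`), the pair of glyphs each picture shows (`pictureGlyphs`, `glyphs_ofPair`: picture = the glyphs of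
  its two factors), every picture shows two straight strokes (`two_straight_strokes`), and the pairs that are NOT pictures are
  exactly those inside {(1.12), (1.13)} (`ofPair_eq_none_iff`; the typer's `pairing_base` reassembles them).
* (v) §5 INSTANCES on the drawn (3.6)₁/(3.7)₁ (p18's `g36a`, this lineage's `B3Eq37Pictures.pic37a`): both vertices show glyph
  10, the φ′-line entry 3, the A′-line entry 4, the two external legs entry 1 and no propagator; 6 legs = 2 external + 4 internal
  (`g36a_symbols`, `g36a_leg_census`, `pic37a_symbols`).
HONEST SCOPE.  (a) Dots, circles, left/right placement and slopes of strokes are not modelled; "wavy strokes with dots" (an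
indefinite number) is the Boolean `wavy` plus the leg numbers of the catalogue.  (b) The model's `Leg` has φ′- and A′-legs only;
Ã-legs are external fields counted by `extVectorLegs` (p18), so "wavy legs" at the count level means A′ + Ã.  (c) Nothing
analytic and nothing on which graphs *"can appear"* (p. 416 l. 1); the typer's analytic dictionary is not restated.
Unit `lit-balaban-p26` gen 39 (literature-prover-lit-balaban-p26-g39-0), HOME `run/shared/lean/pub/lit-balaban/`, 2026-08-23.
-/

open Finset

namespace Literature.MathematicalPhysics.QuantumFieldTheory.Balaban1983to89.B3Eq117LegendPrecise

open B3Prop1 B3Cor23Concrete B3Eq117Legend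

/-! ## §1 The glyph data of (1.17), decided against the catalogue -/

section Glyphs

open Symbol117

/-- The number of STRAIGHT (scalar, φ′) legs a vertex glyph of (1.17) shows, read on the render: × four (glyph 8), —•— two
(glyph 9), the (1.8)–(1.11) glyphs two (the straight line through the circle; 10, 11), the (1.13) glyph and the (1.14)/(1.15)
glyph one (5, 7); `none` for the entries that are not drawn at a vertex (1–4, 6). [cite: Balaban1983Higgs3, (1.17) p.415] -/
def glyphScalarLegs : Symbol117 → Option ℕ
  | vertex16 => some 4
  | vertex17 => some 2
  | vertex18or19 => some 2
  | vertex110or111 => some 2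
  | op113OnScalarLeg => some 1
  | vertex114or115 => some 1
  | _ => none

/-- Whether the glyph carries an ARROWHEAD: glyph 10 only (*"the vertices (1.8) or (1.9)"*; glyph 11 is the same drawing without
it) — the covariant differentiation (D^η_B̃φ′)(b) of (1.8)/(1.9). [cite: Balaban1983Higgs3, (1.17) p.415] -/
def glyphArrow : Symbol117 → Bool
  | vertex18or19 => true
  | _ => false

/-- Whether the glyph contains a WAVY stroke (print's convention: wavy = vector field): entries 2, 4, 6 and the vertex glyphs 7,
10, 11 (their A′/Ã-legs); not 1, 3, 5, 8 (×), 9 (—•—). [cite: Balaban1983Higgs3, (1.17) p.415] -/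
def wavy : Symbol117 → Bool
  | extVectorLeg => true
  | vectorPropagator => true
  | opQkOnVectorLeg => true
  | vertex114or115 => true
  | vertex18or19 => true
  | vertex110or111 => true
  | _ => false

/-- kernel: the wavy entries 2, 4, 6 are the vector versions of the straight entries 1, 3, 5 (the typer's `isScalar`).
[cite: Balaban1983Higgs3, (1.17) p.415] -/
theorem wavy_eq_not_isScalar (s : Symbol117) (b : Bool) (h : s.isScalar = some b) : wavy s = !b := by
  cases s <;> simp [Symbol117.isScalar] at h <;> subst h <;> rfl

/-- kernel: **the number of straight legs a vertex glyph shows is the number of φ′-legs of the vertex** (p18's `scalarLegs`;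
p. 413 (1.6): *"φ′(x) is a scalar field leg"*), through the typer's dictionary `ofVertexKind`. [cite: Balaban1983Higgs3, (1.17) p.415] -/
theorem glyphScalarLegs_ofVertexKind (v : VertexKind) : glyphScalarLegs (ofVertexKind v) = some v.scalarLegs := by
  cases v <;> rfl

/-- kernel: **the arrowhead is the covariant differentiation** — the glyph of `v` carries an arrowhead iff `v` differentiates
(p18's `diffCount = 1`; the typer's fibre lemma `ofVertexKind_eq_vertex18or19_iff`; this lineage's `B3Eq37Pictures.legDiffs`
places it on the first φ′-leg). [cite: Balaban1983Higgs3, (1.17) p.415] -/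
theorem glyphArrow_ofVertexKind (v : VertexKind) : glyphArrow (ofVertexKind v) = true ↔ v.diffCount = 1 := by
  rw [← ofVertexKind_eq_vertex18or19_iff]
  cases v <;> simp [glyphArrow, ofVertexKind]

/-- kernel: **no wavy stroke ⇔ no vector leg of either kind ⇔ the vertex is (1.6), (1.7) or (1.13)**.
[cite: Balaban1983Higgs3, (1.17) p.415] -/
theorem wavy_ofVertexKind (v : VertexKind) :
    wavy (ofVertexKind v) = false ↔ v.vectorLegs = 0 ∧ v.extVectorLegs = 0 ∧ (v = .v16 ∨ v = .v17 ∨ v = .v113) := by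
  cases v <;> simp [ofVertexKind, wavy, VertexKind.vectorLegs, VertexKind.extVectorLegs]

/-- kernel: for ADMISSIBLE parameters a glyph with wavy strokes has at least one A′- or Ã-leg (print's side conditions
n + n′ ≥ 1 for (1.8)/(1.14), n + n′ ≥ 2 for (1.10), n̄ + 1 Ã-legs for the R-vertices). [cite: Balaban1983Higgs3, (1.8)–(1.15) pp.413–414] -/
theorem one_le_vectorLegs_of_wavy {nbar : ℕ} (v : VertexKind) (hv : v.Admissible nbar) (h : wavy (ofVertexKind v) = true) :
    1 ≤ v.vectorLegs + v.extVectorLegs := by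
  cases v <;>
    simp [ofVertexKind, wavy, VertexKind.Admissible, VertexKind.vectorLegs, VertexKind.extVectorLegs] at * <;> omega

/-- kernel: when the glyph is *"made quite precise"* by drawing every leg, its wavy legs (A′ and Ã) number d_v(v), the order in
e(L^kε) (p18's `dv_eq_vectorLegs_add`). [cite: Balaban1983Higgs3, p.420] -/
theorem wavyLegs_eq_dv (v : VertexKind) : v.vectorLegs + v.extVectorLegs = v.dv := (v.dv_eq_vectorLegs_add).symm

end Glyphs

/-! ## §2 "not precise, but … quite precise if we specify a number and nature of legs" -/

section Precise

open Symbol117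

/-- kernel: **p. 415: *"they can be made quite precise if we specify a number and nature of legs"*** — the glyph together with
the NUMBER of A′-legs, the NUMBER of Ã-legs and the NATURE of the last factor (an R-vertex (1.9)/(1.11)/(1.15), carrying
R_{n̄+1}, or not) determines the vertex of the catalogue (1.6)–(1.15). [cite: Balaban1983Higgs3, p.415 (after (1.18))] -/
theorem eq_of_ofVertexKind_eq {v w : VertexKind} (hs : ofVertexKind v = ofVertexKind w) (hA : v.vectorLegs = w.vectorLegs)
    (hE : v.extVectorLegs = w.extVectorLegs) (hR : v.isRVertex = w.isRVertex) : v = w := by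
  cases v <;> cases w <;>
    simp_all [ofVertexKind, VertexKind.vectorLegs, VertexKind.extVectorLegs, VertexKind.isRVertex]

/-- kernel: **p. 415: *"The above notations in (1.17) and (1.18) are not precise"*** — the glyph alone does not determine the
vertex: glyph 10 is shown by (1.8)_{n=1,n′=0}, by (1.8)_{0,1} and by the R-vertex (1.9)_{0,n̄=0}, three different vertices.
[cite: Balaban1983Higgs3, p.415 (after (1.18))] -/
theorem ofVertexKind_not_injective :
    ofVertexKind (.v18 1 0) = ofVertexKind (.v18 0 1) ∧ ofVertexKind (.v18 0 1) = ofVertexKind (.v19 0 0) ∧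
      VertexKind.v18 1 0 ≠ .v18 0 1 ∧ VertexKind.v18 0 1 ≠ .v19 0 0 ∧ VertexKind.v18 1 0 ≠ .v19 0 0 := by
  decide

/-- kernel: the NATURE of the legs is needed, not only their number — (1.8)_{0,1} and (1.9)_{0,0} show the same glyph with the
same numbers of A′-legs (0) and of Ã-legs (1) and differ by the remainder factor R_{n̄+1} only. [cite: Balaban1983Higgs3, p.415 (after (1.18))] -/
theorem nature_of_legs_needed :
    ofVertexKind (.v18 0 1) = ofVertexKind (.v19 0 0) ∧ (VertexKind.v18 0 1).vectorLegs = (VertexKind.v19 0 0).vectorLegs ∧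
      (VertexKind.v18 0 1).extVectorLegs = (VertexKind.v19 0 0).extVectorLegs ∧
      (VertexKind.v18 0 1).isRVertex ≠ (VertexKind.v19 0 0).isRVertex := by
  decide

/-- kernel: glyph 6 (*"the operator Q_k acting on a vector field leg"*) is not the glyph of a whole vertex of the catalogue; on
the model it marks the A′-legs of the vertices (1.14)/(1.15) (the typer's `Graph.operatorSymbol`, the reading adopted here).
[cite: Balaban1983Higgs3, (1.17) p.415] -/
theorem ofVertexKind_ne_opQk (v : VertexKind) : ofVertexKind v ≠ opQkOnVectorLeg := by
  cases v <;> simp [ofVertexKind]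

end Precise

/-! ## §3 "divided into pairs and each pair is replaced by the corresponding propagator" on p18's model -/

section Pairs

variable {nbar : ℕ} (G : Graph nbar)

/-- kernel: a graph of the model has at least one vertex (an internal line exists and *"has a vertex at each endpoint"*).
[cite: Balaban1983Higgs3, p.415 (after (1.18))] -/
theorem nV_pos : 0 < G.nV := by
  obtain ⟨x, _⟩ := G.exists_line
  exact x.1.pos

/-- kernel: … and at least two legs (the endpoints of a line are distinct legs, p18's `other_ne`).
[cite: Balaban1983Higgs3, p.415 (after (1.18))] -/
theorem two_le_card_legs : 2 ≤ Fintype.card (Leg G.kind) := by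
  obtain ⟨x, hx⟩ := G.exists_line
  obtain ⟨y, h⟩ := Option.isSome_iff_exists.mp hx
  rw [← Finset.card_univ]
  exact Finset.one_lt_card.mpr ⟨x, mem_univ _, y, mem_univ _, (G.other_ne x y h).symm⟩

/-- kernel: drawing EVERY leg (*"made quite precise if we specify a number … of legs"*): the legs of a model graph are the
φ′-legs and the A′-legs of its vertices, `#legs = Σ_v (scalarLegs v + vectorLegs v)` (p18's `Leg G.kind = Σ i, Fin _ ⊕ Fin _`).
[cite: Balaban1983Higgs3, p.415 (after (1.18))] -/
theorem card_legs_eq_sum : Fintype.card (Leg G.kind) = ∑ i, ((G.kind i).scalarLegs + (G.kind i).vectorLegs) := by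
  rw [Fintype.card_sigma]
  exact Finset.sum_congr rfl fun i _ => by rw [Fintype.card_sum, Fintype.card_fin, Fintype.card_fin]

/-- The endpoint swap of the lines of G: an internal leg goes to the other endpoint of its line, an external leg stays.
[cite: Balaban1983Higgs3, p.414 (before (1.16))] -/
def lineSwapFun (x : Leg G.kind) : Leg G.kind := (G.other x).getD x

/-- kernel: the endpoint swap is an involution (p18's `other_symm`). [cite: Balaban1983Higgs3, p.414 (before (1.16))] -/
theorem lineSwapFun_involutive : Function.Involutive (lineSwapFun G) := by
  intro x
  unfold lineSwapFun
  cases hx : G.other x with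
  | none => simp [hx]
  | some y => simp [G.other_symm x y hx]

/-- kernel: it preserves the species of a leg (p18's `other_isLeft`). [cite: Balaban1983Higgs3, p.414 (before (1.16))] -/
theorem isLeft_lineSwapFun (x : Leg G.kind) : (lineSwapFun G x).2.isLeft = x.2.isLeft := by
  unfold lineSwapFun
  cases hx : G.other x with
  | none => simp
  | some y => simpa using (G.other_isLeft x y hx).symm

/-- The endpoint swap as a permutation of the legs. [cite: Balaban1983Higgs3, p.414 (before (1.16))] -/
def lineSwap : Equiv.Perm (Leg G.kind) := (lineSwapFun_involutive G).toPerm _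

/-- kernel: it squares to the identity. [cite: Balaban1983Higgs3, p.414 (before (1.16))] -/
theorem lineSwap_sq : lineSwap G ^ 2 = 1 := by
  refine Equiv.ext fun x => ?_
  rw [sq, Equiv.Perm.mul_apply, Equiv.Perm.one_apply]
  exact lineSwapFun_involutive G x

/-- kernel: its support is the set of INTERNAL legs (an internal leg moves because the endpoints of a line are distinct, an
external leg is fixed). [cite: Balaban1983Higgs3, p.414 (before (1.16))] -/
theorem support_lineSwap : (lineSwap G).support = univ.filter fun x : Leg G.kind => (G.other x).isSome := by
  ext x
  simp only [Equiv.Perm.mem_support, mem_filter, mem_univ, true_and]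
  show lineSwapFun G x ≠ x ↔ _
  unfold lineSwapFun
  cases hx : G.other x with
  | none => simp
  | some y => simpa using G.other_ne x y hx

/-- kernel: **p. 414: *"they are divided into pairs and each pair is replaced by the corresponding propagator"*** — on the model
the lines pair off the internal legs: THE NUMBER OF INTERNAL LEGS OF A GRAPH IS EVEN. [cite: Balaban1983Higgs3, p.414 (before (1.16))] -/
theorem two_dvd_card_internal : 2 ∣ (univ.filter fun x : Leg G.kind => (G.other x).isSome).card := by
  rw [← support_lineSwap]
  exact Equiv.Perm.two_dvd_card_support (lineSwap_sq G)

/-- The endpoint swap restricted to ONE species of legs (`b = true`: the φ′-legs, `b = false`: the A′-legs) — entries 3 and 4 of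
(1.17) are different lines. [cite: Balaban1983Higgs3, (1.17) p.415] -/
def speciesSwapFun (b : Bool) (x : Leg G.kind) : Leg G.kind := if x.2.isLeft = b then lineSwapFun G x else x

/-- kernel: also an involution. [cite: Balaban1983Higgs3, p.414 (before (1.16))] -/
theorem speciesSwapFun_involutive (b : Bool) : Function.Involutive (speciesSwapFun G b) := by
  intro x
  unfold speciesSwapFun
  by_cases h : x.2.isLeft = b
  · rw [if_pos h, if_pos (by rw [isLeft_lineSwapFun]; exact h)]
    exact lineSwapFun_involutive G x
  · rw [if_neg h, if_neg h]

/-- The species-restricted endpoint swap as a permutation of the legs. [cite: Balaban1983Higgs3, p.414 (before (1.16))] -/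
def speciesSwap (b : Bool) : Equiv.Perm (Leg G.kind) := (speciesSwapFun_involutive G b).toPerm _

/-- kernel: it squares to the identity. [cite: Balaban1983Higgs3, p.414 (before (1.16))] -/
theorem speciesSwap_sq (b : Bool) : speciesSwap G b ^ 2 = 1 := by
  refine Equiv.ext fun x => ?_
  rw [sq, Equiv.Perm.mul_apply, Equiv.Perm.one_apply]
  exact speciesSwapFun_involutive G b x

/-- kernel: its support is the set of internal legs of the species `b`. [cite: Balaban1983Higgs3, p.414 (before (1.16))] -/
theorem support_speciesSwap (b : Bool) :
    (speciesSwap G b).support = univ.filter fun x : Leg G.kind => (G.other x).isSome ∧ x.2.isLeft = b := by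
  ext x
  simp only [Equiv.Perm.mem_support, mem_filter, mem_univ, true_and]
  show speciesSwapFun G b x ≠ x ↔ _
  unfold speciesSwapFun lineSwapFun
  by_cases h : x.2.isLeft = b
  · rw [if_pos h]
    cases hx : G.other x with
    | none => simp
    | some y => simpa [h] using G.other_ne x y hx
  · rw [if_neg h]
    simp [h]

/-- kernel: **species by species** — *"All the A′-legs are contracted, i.e. they are divided into pairs … the remaining [φ′-legs]
are again divided into pairs"* (p. 414): the number of internal φ′-legs of a model graph is even, and so is the number of internal
A′-legs (scalar lines join φ′-legs, vector lines A′-legs: p18's `other_isLeft`). [cite: Balaban1983Higgs3, p.414 (before (1.16))] -/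
theorem two_dvd_card_internal_species (b : Bool) :
    2 ∣ (univ.filter fun x : Leg G.kind => (G.other x).isSome ∧ x.2.isLeft = b).card := by
  rw [← support_speciesSwap]
  exact Equiv.Perm.two_dvd_card_support (speciesSwap_sq G b)

/-- kernel: legs are external or internal — (number of legs) = p18's *"(a number of external legs)"* `numExtLegs` + the even
number of internal legs. [cite: Balaban1983Higgs3, (2.17) p.429] -/
theorem card_legs_eq_numExtLegs_add :
    Fintype.card (Leg G.kind) = G.numExtLegs + (univ.filter fun x : Leg G.kind => (G.other x).isSome).card := by
  rw [G.numExtLegs_eq_card, ← Finset.card_univ]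
  have h := Finset.card_filter_add_card_filter_not (s := (univ : Finset (Leg G.kind))) (p := fun x => G.other x = none)
  rw [← h]
  congr 2
  exact filter_congr fun x _ => by rw [Option.isSome_iff_ne_none]

/-- kernel: the legs the typer's dictionary draws WITHOUT a propagator symbol (`Graph.lineSymbol G x = none`, i.e. as entries 1/2
*"an external … field"*) are exactly p18's external legs, `numExtLegs` in number. [cite: Balaban1983Higgs3, (1.17) p.415] -/
theorem card_lineSymbol_none_eq_numExtLegs :
    (univ.filter fun x : Leg G.kind => Graph.lineSymbol G x = none).card = G.numExtLegs := by
  rw [G.numExtLegs_eq_card]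
  congr 1
  refine filter_congr fun x _ => ?_
  rw [Graph.lineSymbol_eq]
  cases G.other x <;> simp

end Pairs

/-! ## §4 (1.18) read with the glyphs -/

section Products

open Symbol117 Expr1215 Product118

/-- The legend entry an expression type is drawn with in (1.18): (1.12) ↦ entry 1 (p. 415 l. 1–2: *"The external scalar field is
a_kG_k(Ω, B̃)Q_k(B̃)φ or (1.12)"*), (1.13) ↦ entry 5, (1.14)/(1.15) ↦ entry 7. [cite: Balaban1983Higgs3, (1.18) p.415] -/
def exprSymbol : Expr1215 → Symbol117
  | .e112 => extScalarLeg
  | .e113 => op113OnScalarLeg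
  | .e114 _ _ => vertex114or115
  | .e115 _ _ => vertex114or115

/-- kernel: consistent with the typer's two dictionaries — an expression with a vertex (`toVertexKind`) is drawn with the glyph of
that vertex (`ofVertexKind`). [cite: Balaban1983Higgs3, (1.18) p.415] -/
theorem exprSymbol_toVertexKind (e : Expr1215) (v : VertexKind) (h : e.toVertexKind = some v) :
    ofVertexKind v = exprSymbol e := by
  cases e <;> simp [Expr1215.toVertexKind] at h <;> subst h <;> rfl

/-- The pair of glyphs each picture of (1.18) shows: entry 1 into entry 7; entry 5 into entry 7; entry 7 twice.
[cite: Balaban1983Higgs3, (1.18) p.415] -/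
def pictureGlyphs : Product118 → Multiset Symbol117
  | .p112x1415 => {extScalarLeg, vertex114or115}
  | .p113x1415 => {op113OnScalarLeg, vertex114or115}
  | .p1415x1415 => {vertex114or115, vertex114or115}

/-- kernel: **each picture of (1.18) is the pair of glyphs of its two factors** (the typer's classification `ofPair` read with
`exprSymbol`). [cite: Balaban1983Higgs3, (1.18) p.415] -/
theorem glyphs_ofPair (e e' : Expr1215) (p : Product118) (h : ofPair e e' = some p) :
    pictureGlyphs p = {exprSymbol e, exprSymbol e'} := by
  cases e <;> cases e' <;> cases p <;> simp [ofPair, Expr1215.isAvg] at h <;>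
    first | rfl | exact Multiset.pair_comm _ _

/-- The number of straight strokes an expression type shows: one each ((1.12): the external straight stroke; (1.13)–(1.15): the
single φ′-leg of their vertex, p18's `scalarLegs = 1`). [cite: Balaban1983Higgs3, (1.12)–(1.15) pp.413–414] -/
def straightStrokes : Expr1215 → ℕ
  | .e112 => 1
  | e => match e.toVertexKind with
    | some v => v.scalarLegs
    | none => 0

/-- kernel: the straight strokes of an expression with a vertex are the φ′-legs of that vertex; (1.12) shows one.
[cite: Balaban1983Higgs3, (1.12)–(1.15) pp.413–414] -/
theorem straightStrokes_spec (e : Expr1215) :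
    straightStrokes e = 1 ∧ ∀ v, e.toVertexKind = some v → straightStrokes e = v.scalarLegs := by
  cases e <;> simp [straightStrokes, Expr1215.toVertexKind, VertexKind.scalarLegs]

/-- kernel: every picture of (1.18) — indeed every pair of expression types — shows exactly TWO straight strokes, one per factor
(the stroke entering from the left and the φ′-leg of the averaging vertex). [cite: Balaban1983Higgs3, (1.18) p.415] -/
theorem two_straight_strokes (e e' : Expr1215) : straightStrokes e + straightStrokes e' = 2 := by
  rw [(straightStrokes_spec e).1, (straightStrokes_spec e').1]

/-- kernel: **the pairs that are NOT pictures of (1.18) are exactly the pairs inside {(1.12), (1.13)}** — (1.12)·(1.12),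
(1.12)·(1.13), (1.13)·(1.13) (complement of the typer's `ofPair_isSome_iff`; by the typer's `B3Eq114AveragingVertices.pairing_base`
they reassemble the unperturbed Gaussian term −½a_k|φ(y) − (Q_k(B̃)φ′)(y)|², which is why print does not draw them).
[cite: Balaban1983Higgs3, p.414 (after (1.15))] -/
theorem ofPair_eq_none_iff (e e' : Expr1215) :
    ofPair e e' = none ↔ (e = .e112 ∨ e = .e113) ∧ (e' = .e112 ∨ e' = .e113) := by
  cases e <;> cases e' <;> simp [ofPair, Expr1215.isAvg]

/-- kernel: every picture of (1.18) occurs, with (1.14) and with (1.15) as the averaging factor (no surplus picture).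
[cite: Balaban1983Higgs3, (1.18) p.415] -/
theorem ofPair_surjective (p : Product118) (n n' : ℕ) :
    ∃ e, ofPair e (.e114 n n') = some p ∧ ofPair e (.e115 n n') = some p := by
  cases p
  exacts [⟨.e112, rfl, rfl⟩, ⟨.e113, rfl, rfl⟩, ⟨.e114 0 0, rfl, rfl⟩]

end Products

/-! ## §5 Instances: the drawn graph (3.6)₁ and its counterterm picture (3.7)₁ read with the legend -/

section Instances

open B3Sect3LowestOrderGraphs B3Eq37Pictures Symbol117

variable {nbar : ℕ} (hn : 1 ≤ nbar)

/-- kernel: **(3.6)₁ p. 435 read with (1.17)** (p18's `g36a`; legs `sLeg i j`, `vLeg i` of `B3Eq37Pictures`): both vertices show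
glyph 10 (with its arrowhead), the differentiated φ′-legs lie on a line drawn as entry 3, the A′-legs on a line drawn as entry 4,
the undifferentiated φ′-legs carry no propagator symbol and are drawn as entry 1 (external scalar legs).
[cite: Balaban1983Higgs3, (3.6) p.435] -/
theorem g36a_symbols (i : Fin 2) :
    Graph.vertexSymbol (g36a nbar hn) i = vertex18or19 ∧ glyphArrow (Graph.vertexSymbol (g36a nbar hn) i) = true ∧
      Graph.lineSymbol (g36a nbar hn) (sLeg i 0) = some scalarPropagator ∧
      Graph.lineSymbol (g36a nbar hn) (vLeg i) = some vectorPropagator ∧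
      Graph.lineSymbol (g36a nbar hn) (sLeg i 1) = none ∧ Graph.legSymbol (g36a nbar hn) (sLeg i 1) = extScalarLeg := by
  refine ⟨rfl, rfl, ?_, ?_, ?_, rfl⟩ <;>
    simp only [Graph.lineSymbol_eq, g36a_other_sLeg0, g36a_other_sLeg1, g36a_other_vLeg] <;> rfl

/-- kernel: (3.6)₁ has 6 legs: 2 external and 4 internal (two lines), in accordance with `two_dvd_card_internal`.
[cite: Balaban1983Higgs3, (3.6) p.435] -/
theorem g36a_leg_census :
    Fintype.card (Leg (g36a nbar hn).kind) = 6 ∧ (g36a nbar hn).numExtLegs = 2 ∧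
      (univ.filter fun x : Leg (g36a nbar hn).kind => ((g36a nbar hn).other x).isSome).card = 4 := by
  have h1 : Fintype.card (Leg (g36a nbar hn).kind) = 6 := rfl
  have h2 : (g36a nbar hn).numExtLegs = 2 := rfl
  refine ⟨h1, h2, ?_⟩
  have h := card_legs_eq_numExtLegs_add (g36a nbar hn)
  omega

/-- kernel: the counterterm picture (3.7)₁ (`pic37a`, p. 417's convention) is the SAME drawn graph — same glyphs leg by leg —
with its two entry-1 legs localized at the vertex `x = 0` (`loc37_ext`). [cite: Balaban1983Higgs3, (3.7) p.435] -/
theorem pic37a_symbols :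
    (pic37a hn).G = g36a nbar hn ∧ (pic37a hn).loc (sLeg 0 1) = (0 : Fin 2) ∧ (pic37a hn).loc (sLeg 1 1) = (0 : Fin 2) ∧
      Graph.legSymbol (pic37a hn).G (sLeg 0 1) = extScalarLeg ∧ Graph.lineSymbol (pic37a hn).G (sLeg 0 1) = none :=
  ⟨rfl, (pic37a_loc hn _).trans loc37_ext.1, (pic37a_loc hn _).trans loc37_ext.2, (g36a_symbols hn 0).2.2.2.2.2,
    (g36a_symbols hn 0).2.2.2.2.1⟩

end Instances

end Literature.MathematicalPhysics.QuantumFieldTheory.Balaban1983to89.B3Eq117LegendPrecise
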